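import Summits.NavierStokesRegularity.NavierStokesRegularity.Theorems.NoOverheating.Negative.ExcludedStrataCensusV3
import Summits.NavierStokesRegularity.NavierStokesRegularity.Theorems.NoOverheating.Negative.UnidirectionalVorticityWindowsExcluded
import Summits.NavierStokesRegularity.NavierStokesRegularity.Theorems.NoOverheating.Negative.TranslationalSymmetryExcluded
import Literature.Analysis.FluidPDE.VorticityDoubleConeSelfSimilar
import Literature.Analysis.FluidPDE.GigaMiura2011UnidirectionalVorticityHolds
import Literature.Analysis.FluidPDE.CurlFreeLiouville

/-!
# KJ-48 — CENSUS v4 of the excluded strata of route `AngularGalerkinLadder`'s window sequences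
# ((S0)–(S8) of `excludedStrata_windowSequences_v3` + (S9) vorticity directions + (S10)
# translational / helical symmetry + (S11) profiles regular at the space-time origin + (S12)
# planar (line-parallel) slice vorticity)

Refuter lineage, Negative lane of crux K2 `NoOverheating` (supports, does not decide).  Pure
assembly — this file proves NOTHING new about fluids: it folds three further kernel rows into the
census statement of record, `excludedStrata_windowSequences_v4`, "what an admissible window
sequence of K2 can NOT be":

* (S9) the VORTICITY-DIRECTION corner (Giga–Miura 2011 Thm 1.3 / Prop 2.2, Constantin–Fefferman
  type): (S9a) every profile has unidirectional slice vorticity `curl uₙ(t) = |curl uₙ(t)| eₙ(t)`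
  (`no_windowSequence_unidirectional`), or (S9b) every profile satisfies the continuous-alignment
  condition (CA) on the window `(−1, 0) × ℝ³` above SOME threshold with SOME modulus, both allowed
  to depend on the profile (`no_windowSequence_continuousAlignment`; for an exactly rotated-DSS
  field (CA) self-improves to (S9a), `unidirectional_of_continuousAlignment`, KJ-46);
* (S10) the TRANSLATIONAL corner: some profile's `t = −1` slice norm is invariant under a screw
  displacement `y ↦ S y + b` with `S b = b`, `b ≠ 0` — 2D, 2½D, axially periodic and helically
  symmetric profiles (`no_windowProfile_screw_invariant`, KJ-47: Type-I decay alone);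
* (S11) the REGULAR-ORIGIN corner: some profile is bounded on a backward parabolic cylinder
  `Q_ρ(0,0)` (S11a) — in particular some profile is STEADY with a continuous slice (S11b) — by the
  tree's `IsRotatedDSS.eq_zero_of_norm_le_parabolicCylinder` (Chae–Wolf 2017 §3 step 1: a DSS
  field bounded near the space-time origin vanishes), proved here as the single-profile lemmas
  `no_windowProfile_locallyBounded` / `no_windowProfile_steady`;
* (S12) the PLANAR-VORTICITY corner (sign-free form of (S9a), one slice, one profile): some
  profile's `t = −1` slice has vorticity everywhere parallel to ONE line, `curl uₙ(−1)(x) = a(x) e`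
  with `a` of any sign (e.g. planar / 2D-reducible slices, irrotational slices `e = 0`) — by
  Giga–Miura's slice lemma (tree: `translationInvariant_of_curl_parallel`: a bounded `C²`
  divergence-free field with curl parallel to `e ≠ 0` is invariant along `e`; an irrotational one
  is constant, `eq_of_curl_eq_zero_of_isDivFree_of_bounded`) the slice norm is translation
  invariant, which is row (S10) (`no_windowProfile_parallelVorticity`).

WHAT ESCAPES every row of v4: `C₀ > ε₀`; genuinely discrete RDSS whose usable powers twist in
Pineau–Vicol's open middle band (or meet only coarse windows); no hidden factor below `λ₁(C₀)`;
hidden continuous rotation (if any) with speeds eventually inside `(β₁, β₂)`; a non-degenerate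
degree-`−1` tail germ; vorticity directions that oscillate at the profile's own scale with no
modulus at any threshold and are not confined to one line on the `t = −1` slice (the sine-form
variant of (CA) with a POSITIVE defect is NOT covered); no isometric symmetry with unbounded
orbits; and every profile genuinely singular at `(0,0)` (unbounded on every `Q_ρ(0,0)`).  WHAT
THIS IS NOT: not `¬NoOverheating`; no new Literature fact, no definition; standard axioms only.
[cite: GigaMiura2011, Theorem 1.3 and Proposition 2.2]
[cite: MahalovTitiLeibovich1990, main theorem (global strong solutions with helical symmetry; quoted in Robinson–Rodrigo–Sadowski 2016, PDF p. 112)]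
[cite: ChaeWolf2017RemovingDSS, §3 step 1 (arXiv:1610.09464 p. 8)]
[cite: KochNadirashviliSereginSverak2009, Theorems 1.2–1.3 and 5.3]
[cite: PineauVicol2026, Theorem 1.7 (i)–(ii) (arXiv:2607.09619 p. 7)]
[cite: AlbrittonBarker2019, Theorems 1.2 and 4.1 (arXiv:1811.00502 pp. 4, 9)] -/

namespace Summit.NavierStokesRegularity.AngularGalerkinLadderExcludedStrataCensusV4

open Set Filter MeasureTheory Topology Function
open scoped ENNReal
open Literature.Analysis Literature.Analysis.FluidPDE
open Summit.NavierStokesRegularity.FluidComputer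
open Summit.NavierStokesRegularity.NavierStokesRegularity.Theses.AngularGalerkinLadder
open Summit.NavierStokesRegularity.AngularGalerkinLadderExcludedStrataCensusV3
open Summit.NavierStokesRegularity.AngularGalerkinLadderUnidirectionalVorticityWindowsExcluded
open Summit.NavierStokesRegularity.AngularGalerkinLadderTranslationalSymmetryExcluded

/-- **(S11a) No window profile is bounded near the space-time origin**: a window profile with
`0 < δ` that is bounded on some backward parabolic cylinder `Q_ρ(0,0) = (−ρ², 0) × B_ρ(0)` is
contradictory — by rotated discrete self-similarity the bound `B` on `Q_ρ` becomes `B/cᵏ` on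
`Q_{cᵏρ}`, so the profile vanishes on `t < 0`, against the floor at `t = −1`.
[cite: ChaeWolf2017RemovingDSS, §3 step 1 (arXiv:1610.09464 p. 8)] -/
theorem no_windowProfile_locallyBounded {L₁ : ℕ} {C₁ cmin₁ cmax₁ δ₁ ε₁ c₁' : ℝ}
    {R₁ : EuclideanSpace ℝ (Fin 3) ≃ₗᵢ[ℝ] EuclideanSpace ℝ (Fin 3)}
    {u₁ : ℝ → EuclideanSpace ℝ (Fin 3) → EuclideanSpace ℝ (Fin 3)}
    {p₁ : ℝ → EuclideanSpace ℝ (Fin 3) → ℝ}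
    {d₁ : ℝ → EuclideanSpace ℝ (Fin 3) → EuclideanSpace ℝ (Fin 3)} (hδ : 0 < δ₁)
    (hW : AngularLadder.IsWindowProfile L₁ C₁ cmin₁ cmax₁ δ₁ ε₁ c₁' R₁ u₁ p₁ d₁) {ρ B : ℝ}
    (hρ : 0 < ρ)
    (hB : ∀ z ∈ parabolicCylinder ρ (0 : ℝ × EuclideanSpace ℝ (Fin 3)), ‖u₁ z.1 z.2‖ ≤ B) :
    False := by
  obtain ⟨hP, -, -, ⟨x, hx⟩, -⟩ := hW
  have h0 := hP.isRotatedDSS.eq_zero_of_norm_le_parabolicCylinder hP.one_lt hρ hB (-1)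
    (by norm_num) x
  rw [h0, norm_zero] at hx
  exact absurd hx (not_le.mpr hδ)

/-- **(S11b) No window profile is steady**: a window profile with `0 < δ` whose slices on `t < 0`
all equal one continuous field `U` is contradictory (`U` is bounded on the closed unit ball, so the
profile is bounded on `Q₁(0,0)`). [cite: ChaeWolf2017RemovingDSS, §3 step 1 (arXiv:1610.09464 p. 8)] -/
theorem no_windowProfile_steady {L₁ : ℕ} {C₁ cmin₁ cmax₁ δ₁ ε₁ c₁' : ℝ}
    {R₁ : EuclideanSpace ℝ (Fin 3) ≃ₗᵢ[ℝ] EuclideanSpace ℝ (Fin 3)}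
    {u₁ : ℝ → EuclideanSpace ℝ (Fin 3) → EuclideanSpace ℝ (Fin 3)}
    {p₁ : ℝ → EuclideanSpace ℝ (Fin 3) → ℝ}
    {d₁ : ℝ → EuclideanSpace ℝ (Fin 3) → EuclideanSpace ℝ (Fin 3)} (hδ : 0 < δ₁)
    (hW : AngularLadder.IsWindowProfile L₁ C₁ cmin₁ cmax₁ δ₁ ε₁ c₁' R₁ u₁ p₁ d₁)
    {U : EuclideanSpace ℝ (Fin 3) → EuclideanSpace ℝ (Fin 3)} (hU : Continuous U)
    (hsteady : ∀ t < 0, u₁ t = U) : False := by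
  obtain ⟨B, hB⟩ :=
    (isCompact_closedBall (0 : EuclideanSpace ℝ (Fin 3)) 1).exists_bound_of_continuousOn
      hU.continuousOn
  refine no_windowProfile_locallyBounded hδ hW one_pos (B := B) fun z hz => ?_
  rw [mem_parabolicCylinder] at hz
  rw [hsteady z.1 hz.1.2]
  exact hB z.2 (Metric.mem_closedBall.mpr hz.2.le)

/-- **(S12) No window profile has line-parallel vorticity on the `t = −1` slice**: if
`curl u(−1)(x) = a(x) e` for one vector `e` and scalars `a(x)` of ANY sign, the slice is invariant
under a non-zero translation — along `e` by Giga–Miura's slice lemma when `e ≠ 0` (the slice is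
`C²`, divergence free and bounded by `|C₀|` from the Type-I decay), along any vector when `e = 0`
(an irrotational divergence-free bounded field is constant) — and row (S10)
(`no_windowProfile_translation_invariant`) applies.  Sign-free, single-slice, single-profile
strengthening of (S9a). [cite: GigaMiura2011, Prop. 2.2, proof (§2.1; HUPS preprint #956 p. 8)] -/
theorem no_windowProfile_parallelVorticity {L₁ : ℕ} {C₁ cmin₁ cmax₁ δ₁ ε₁ c₁' : ℝ}
    {R₁ : EuclideanSpace ℝ (Fin 3) ≃ₗᵢ[ℝ] EuclideanSpace ℝ (Fin 3)}
    {u₁ : ℝ → EuclideanSpace ℝ (Fin 3) → EuclideanSpace ℝ (Fin 3)}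
    {p₁ : ℝ → EuclideanSpace ℝ (Fin 3) → ℝ}
    {d₁ : ℝ → EuclideanSpace ℝ (Fin 3) → EuclideanSpace ℝ (Fin 3)} (hδ : 0 < δ₁)
    (hW : AngularLadder.IsWindowProfile L₁ C₁ cmin₁ cmax₁ δ₁ ε₁ c₁' R₁ u₁ p₁ d₁)
    {e : EuclideanSpace ℝ (Fin 3)} (hpar : ∀ x, ∃ a : ℝ, curl (u₁ (-1)) x = a • e) : False := by
  have hP := hW.isRungProfile
  have hm1 : (-1 : ℝ) ∈ Iio 0 := by norm_num
  have hC2 : ContDiff ℝ 2 (u₁ (-1)) :=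
    (hP.classical.smooth_velocity.contDiff_slice hm1).of_le (by norm_cast)
  have hdiv : VectorCalculus.IsDivFree (u₁ (-1)) := hP.classical.divFree (-1) hm1
  have hbdd : ∃ M : ℝ, ∀ x, ‖u₁ (-1) x‖ ≤ M := by
    refine ⟨|C₁|, fun x => (hP.hasTypeIDecay (-1) (by norm_num) x).trans ?_⟩
    rw [neg_neg, Real.sqrt_one]
    calc C₁ / (‖x‖ + 1) ≤ |C₁| / (‖x‖ + 1) :=
          div_le_div_of_nonneg_right (le_abs_self _) (by positivity)
      _ ≤ |C₁| := div_le_self (abs_nonneg _) (by linarith [norm_nonneg x])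
  by_cases he : e = 0
  · -- irrotational slice: constant (harmonic Liouville), hence translation invariant
    have hcurl : ∀ x, curl (u₁ (-1)) x = 0 := fun x => by
      obtain ⟨a, ha⟩ := hpar x
      rw [ha, he, smul_zero]
    obtain ⟨M, hM⟩ := hbdd
    have hconst : ∀ x y, u₁ (-1) x = u₁ (-1) y :=
      eq_of_curl_eq_zero_of_isDivFree_of_bounded hC2 hcurl hdiv hM
    obtain ⟨b, hb⟩ := NormedSpace.exists_lt_norm ℝ (EuclideanSpace ℝ (Fin 3)) 0
    exact no_windowProfile_translation_invariant hδ hW (norm_pos_iff.1 hb) fun x => by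
      rw [hconst (x + b) x]
  · -- curl parallel to `e ≠ 0`: the slice is invariant along `e` (Giga–Miura's slice lemma)
    exact no_windowProfile_translation_invariant hδ hW he fun x => by
      have h := translationInvariant_of_curl_parallel hC2 hdiv hbdd he hpar x 1
      rw [one_smul] at h
      rw [h]

/-- **Census theorem v4: the excluded strata (S0)–(S12) of K2's window sequences.**  As
`excludedStrata_windowSequences_v3`, plus: (S9a) unidirectional slice vorticity for every profile;
(S9b) Giga–Miura continuous alignment (CA) for every profile, with profile-dependent threshold `d₀`
and modulus `η → 0⁺`; (S10) some profile whose `t = −1` slice norm is invariant under a screw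
displacement of non-zero pitch (`S b = b`, `b ≠ 0`); (S11a) some profile bounded on a backward
parabolic cylinder at the origin; (S11b) some steady profile with a continuous slice; (S12) some
profile whose `t = −1` slice vorticity is everywhere parallel to one line (any signs) — all for ANY
window `1 < cmin ≤ cmax` and ANY rotations. [cite: GigaMiura2011, Theorem 1.3 and Proposition 2.2]
[cite: ChaeWolf2017RemovingDSS, §3 step 1 (arXiv:1610.09464 p. 8)]
[cite: MahalovTitiLeibovich1990, main theorem (global strong solutions with helical symmetry; quoted in Robinson–Rodrigo–Sadowski 2016, PDF p. 112)] -/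
theorem excludedStrata_windowSequences_v4 :
    ∃ ε₀ : ℝ, 0 < ε₀ ∧ ∀ C₀ : ℝ, ∃ κ α₁ c₁ α₂ c₂ lam₁ β₁ β₂ : ℝ,
      1 < κ ∧ 0 < α₁ ∧ 1 < c₁ ∧ 0 < α₂ ∧ 1 < c₂ ∧ 1 < lam₁ ∧ 0 < β₁ ∧ 0 < β₂ ∧
      ∀ {cmin cmax δ : ℝ} {L : ℕ → ℕ} {ε c : ℕ → ℝ}
        {R : ℕ → (EuclideanSpace ℝ (Fin 3) ≃ₗᵢ[ℝ] EuclideanSpace ℝ (Fin 3))}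
        {u : ℕ → ℝ → EuclideanSpace ℝ (Fin 3) → EuclideanSpace ℝ (Fin 3)}
        {p : ℕ → ℝ → EuclideanSpace ℝ (Fin 3) → ℝ}
        {d : ℕ → ℝ → EuclideanSpace ℝ (Fin 3) → EuclideanSpace ℝ (Fin 3)},
        1 < cmin → 0 < δ → Tendsto ε atTop (𝓝 0) →
        (∀ n, AngularLadder.IsWindowProfile (L n) C₀ cmin cmax δ (ε n) (c n) (R n) (u n) (p n)
          (d n)) →
        ¬ (C₀ ≤ ε₀ ∨
           (∀ n, ∀ t < 0, IsAxisymmetric (u n t)) ∨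
           (∃ q : ℕ, 0 < q ∧ cmax ^ q < κ ∧
              ∀ x, Tendsto (fun n => ((R n) ^ q) x) atTop (𝓝 x)) ∨
           (∃ (q : ℕ) (g : ℕ → (EuclideanSpace ℝ (Fin 3) ≃ₗᵢ[ℝ] EuclideanSpace ℝ (Fin 3)))
              (θ : ℕ → ℝ),
              0 < q ∧ cmax ^ q < c₁ ∧ (∀ n x, ((R n) ^ q) x = g n (rotZ (θ n) ((g n).symm x))) ∧
              ∀ n, |θ n| ≤ 2 * α₁ * (q * Real.log (c n))) ∨
           (∃ (Θ ℓ : ℝ) (g : ℕ → (EuclideanSpace ℝ (Fin 3) ≃ₗᵢ[ℝ] EuclideanSpace ℝ (Fin 3)))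
              (θ : ℕ → ℝ),
              ℓ < Real.log c₂ ∧ (∀ n x, R n x = g n (rotZ (θ n) ((g n).symm x))) ∧
              (∀ n, |θ n| ≤ Θ) ∧ (∀ n, 2 * α₂ * Real.log (c n) ≤ |θ n|) ∧
              ∀ n, (1 + (θ n / (2 * Real.log (c n))) ^ 2) * Real.log (c n) ≤ ℓ) ∨
           (∃ lam : ℝ, 1 < lam ∧ lam < lam₁ ∧ ∀ n, IsDiscretelySelfSimilar lam (u n)) ∨
           (∀ n, IsSelfSimilar (u n)) ∨
           (∃ (g : ℕ → (EuclideanSpace ℝ (Fin 3) ≃ₗᵢ[ℝ] EuclideanSpace ℝ (Fin 3))) (α : ℕ → ℝ),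
              (∀ n (μ : ℝ), 1 < μ → IsRotatedDSS μ
                (((g n).symm.trans (rotZLIE (2 * α n * Real.log μ))).trans (g n)) (u n)) ∧
              ∀ n, |α n| ≤ β₁ ∨ β₂ ≤ |α n|) ∨
           (∃ M : ℝ≥0∞, M < ⊤ ∧ ∀ n, eLpNorm (u n (-1)) 3 volume ≤ M) ∨
           (∃ M : ℝ≥0∞, M < ⊤ ∧ ∀ n, eLpNorm (u n (-1)) 2 volume ≤ M) ∨
           (∀ η : ℝ, 0 < η → ∃ ρ : ℝ, ∀ n x, ρ ≤ ‖x‖ → ‖x‖ * ‖u n (-1) x‖ ≤ η) ∨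
           (∀ n, ∀ t < 0, ∃ e : EuclideanSpace ℝ (Fin 3), ∀ x,
              curl (u n t) x = ‖curl (u n t) x‖ • e) ∨
           (∀ n, ∃ (d₀ : ℝ) (η : ℝ → ℝ), Tendsto η (𝓝[>] 0) (𝓝 0) ∧
              ∀ s ∈ Ioo (-1 : ℝ) 0, ∀ x y, d₀ < ‖curl (u n s) x‖ → d₀ < ‖curl (u n s) y‖ →
                ‖vorticityDirection (curl (u n s)) x - vorticityDirection (curl (u n s)) y‖ ≤
                  η ‖x - y‖) ∨
           (∃ (n : ℕ) (S : EuclideanSpace ℝ (Fin 3) ≃ₗᵢ[ℝ] EuclideanSpace ℝ (Fin 3))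
              (b : EuclideanSpace ℝ (Fin 3)), S b = b ∧ b ≠ 0 ∧
              ∀ x, ‖u n (-1) (S x + b)‖ = ‖u n (-1) x‖) ∨
           (∃ (n : ℕ) (ρ B : ℝ), 0 < ρ ∧
              ∀ z ∈ parabolicCylinder ρ (0 : ℝ × EuclideanSpace ℝ (Fin 3)), ‖u n z.1 z.2‖ ≤ B) ∨
           (∃ (n : ℕ) (U : EuclideanSpace ℝ (Fin 3) → EuclideanSpace ℝ (Fin 3)),
              Continuous U ∧ ∀ t < 0, u n t = U) ∨
           (∃ (n : ℕ) (e : EuclideanSpace ℝ (Fin 3)), ∀ x, ∃ a : ℝ,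
              curl (u n (-1)) x = a • e)) := by
  obtain ⟨ε₀, hε₀, H⟩ := excludedStrata_windowSequences_v3
  refine ⟨ε₀, hε₀, fun C₀ => ?_⟩
  obtain ⟨κ, α₁, c₁, α₂, c₂, lam₁, β₁, β₂, hκ, hα₁, hc₁, hα₂, hc₂, hlam₁, hβ₁, hβ₂, HC⟩ := H C₀
  refine ⟨κ, α₁, c₁, α₂, c₂, lam₁, β₁, β₂, hκ, hα₁, hc₁, hα₂, hc₂, hlam₁, hβ₁, hβ₂,
    fun {cmin cmax δ L ε c R u p d} hcmin hδ hε hW => ?_⟩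
  have HC' := HC hcmin hδ hε hW
  rintro (h0 | h1 | h2 | h3 | h4 | h5 | h5' | h6 | h7 | h7' | h8 | h9 | h9' |
    ⟨n, S, b, hSb, hb, hinv⟩ | ⟨n, ρ, B, hρ, hB⟩ | ⟨n, U, hU, hst⟩ | ⟨n, e, hpar⟩)
  · exact HC' (Or.inl h0)
  · exact HC' (Or.inr (Or.inl h1))
  · exact HC' (Or.inr (Or.inr (Or.inl h2)))
  · exact HC' (Or.inr (Or.inr (Or.inr (Or.inl h3))))
  · exact HC' (Or.inr (Or.inr (Or.inr (Or.inr (Or.inl h4)))))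
  · exact HC' (Or.inr (Or.inr (Or.inr (Or.inr (Or.inr (Or.inl h5))))))
  · exact HC' (Or.inr (Or.inr (Or.inr (Or.inr (Or.inr (Or.inr (Or.inl h5')))))))
  · exact HC' (Or.inr (Or.inr (Or.inr (Or.inr (Or.inr (Or.inr (Or.inr (Or.inl h6))))))))
  · exact HC' (Or.inr (Or.inr (Or.inr (Or.inr (Or.inr (Or.inr (Or.inr (Or.inr (Or.inl h7)))))))))
  · exact HC' (Or.inr (Or.inr (Or.inr (Or.inr (Or.inr (Or.inr (Or.inr (Or.inr (Or.inr
      (Or.inl h7'))))))))))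
  · exact HC' (Or.inr (Or.inr (Or.inr (Or.inr (Or.inr (Or.inr (Or.inr (Or.inr (Or.inr
      (Or.inr h8))))))))))
  · exact no_windowSequence_unidirectional hcmin hδ hε hW h9
  · exact no_windowSequence_continuousAlignment hcmin hδ hε hW h9'
  · exact no_windowProfile_screw_invariant hδ (hW n) S hSb hb hinv
  · exact no_windowProfile_locallyBounded hδ (hW n) hρ hB
  · exact no_windowProfile_steady hδ (hW n) hU hst
  · exact no_windowProfile_parallelVorticity hδ (hW n) hpar

end Summit.NavierStokesRegularity.AngularGalerkinLadderExcludedStrataCensusV4
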